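import Literature.NumberTheory.Automorphic.IsomorphismTheoremUniqueLie
import Literature.NumberTheory.Automorphic.RootSpaceLine
import Literature.NumberTheory.Automorphic.LieCentralizerTorus
import HarnessLib

/-!
# `IsSplitDual.isSplit` holds: split dual group structures have trivial Galois action
(trunk T-AUTOMORPHIC, G25 AutomorphicL; discharge of the named fact of `DualGroup.lean`)

`DualGroup.lean` vendors, for a dual group structure `D : L.DualGroupStr P b` on an L-group datum
over `ℂ`, the named fact `IsSplitDual.isSplit D : D.IsSplitDual → L.IsSplit` — if `Γ_F` acts
trivially on the based root datum `(P, b)` then it acts trivially on `Ĝ = L.dual` (the uniqueness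
half of the isomorphism theorem, Springer, *Linear Algebraic Groups*, 9.6.2, applied as in Borel,
*Automorphic L-functions*, §2.1). `IsomorphismTheoremUniqueLie.lean` reduced it
(`IsSplitDual.isSplit_of_finrank_le_one`, `torus_sup_rootSubgroups_eq_of_lieWeights_subset`) to
three statements about the complex connected reductive group `Ĝ` and its maximal torus `T̂`:
`P ⊆ R` (non-zero weights of `T̂` in `Lie(Ĝ)` are roots), `dim 𝔤_α ≤ 1` for roots `α`, and
`𝔤^T̂ ⊆ Lie(T̂)`. All three are now theorems, by the characteristic-zero (Lie algebra) route:

* `P ⊆ R`: `lieWeights_subset_roots` (`LieAlgebraGLNilpotentExp.lean`: the exponential of a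
  nilpotent element of `Lie(G)` lies in `G`);
* `𝔤^T̂ = Lie(T̂)`: `lieWeightSpace_one_eq_lieAlgebraGL` /
  `lieWeightSpace_one_le_lieAlgebraGL_of_charZero` (`LieCentralizerTorus.lean`: Jordan
  decomposition in `Lie(G)`, Chevalley's algebraic hull of a semisimple element, Engel and Cartan's
  criterion for the trace form, and reductivity through the exponential) — Springer 5.4.7 with
  7.6.4 (ii);
* `dim 𝔤_α ≤ 1`: `finrank_lieWeightSpace_le_one_of_lieWeightSpace_one_le` (`RootSpaceLine.lean`:
  the `𝔰𝔩₂` of each root of the root datum, given `𝔤^T̂ ⊆ Lie(T̂)`), here specialised to the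
  roots of `(Ĝ, T̂)`, each of which is `χ_{P.flip.root i}` for some `i`
  (`IsRootDatumOf.range_root`): `finrank_lieWeightSpace_le_one_of_mem_roots`.

Main result: **`LGroupData.DualGroupStr.IsSplitDual.isSplit_holds D : IsSplitDual.isSplit D`**.

## References

* T. A. Springer, *Linear Algebraic Groups*, 2nd ed., Progress in Mathematics 9, Birkhäuser
  (1998), Theorem 9.6.2, 8.1.1–8.1.2, Cor. 5.4.7, Cor. 7.6.4 (ii) [SpringerLAG1998].
* A. Borel, *Automorphic L-functions*, Proc. Sympos. Pure Math. 33.2 (Corvallis 1979), §2.1.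
-/

noncomputable section

open Field

namespace Literature.NumberTheory.Automorphic.LGroupData.DualGroupStr

variable {F : Type*} [Field F]
variable {ι X Y : Type*} [AddCommGroup X] [AddCommGroup Y]
variable {L : LGroupData F} {P : RootPairing ι ℤ X Y} {b : P.Base}
variable (D : L.DualGroupStr P b)

/-- **Root spaces of the complex dual group are lines**: for every root `α` of `(Ĝ, T̂)`,
`dim 𝔤_α ≤ 1` (Springer 8.1.2 for `(Ĝ, T̂)`): `α = χ_{P.flip.root i}` for some `i`
(`IsRootDatumOf.range_root`), `𝔤^T̂ ⊆ Lie(T̂)` holds by `lieWeightSpace_one_le_lieAlgebraGL_of_charZero`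
(`ℂ` has characteristic `0`), and `finrank_lieWeightSpace_le_one_of_lieWeightSpace_one_le`
(`RootSpaceLine.lean`) applies to the root datum `D.isBased.isRootDatumOf`.
[cite: SpringerLAG1998, Cor. 8.1.2] -/
theorem finrank_lieWeightSpace_le_one_of_mem_roots {α : ↥(characterLattice D.torus)}
    (hα : α ∈ roots L.dual D.torus) :
    Module.finrank ℂ ↥(lieWeightSpace L.dual D.torus (α : ↥D.torus →* ℂˣ)) ≤ 1 := by
  have hmem : D.eX (Additive.ofMul α) ∈ Set.range P.flip.root := by
    rw [D.isBased.isRootDatumOf.range_root]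
    exact ⟨α, hα, rfl⟩
  obtain ⟨i, hi⟩ := hmem
  have hci : charOfWeight D.eX (P.flip.root i) = (α : ↥D.torus →* ℂˣ) := by
    rw [hi, D.charOfWeight_eX_apply α]
  rw [← hci]
  exact finrank_lieWeightSpace_le_one_of_lieWeightSpace_one_le D.isConnectedReductive D.isMaximalTorus
    (lieWeightSpace_one_le_lieAlgebraGL_of_charZero D.isConnectedReductive D.isMaximalTorus)
    D.isBased.isRootDatumOf i

/-- **`IsSplitDual.isSplit` holds** (discharge of the named fact of `DualGroup.lean`; Springer
9.6.2, uniqueness, for the complex dual group, via `IsSplitDual.isSplit_of_finrank_le_one` and the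
Lie-algebra criteria `lieWeights_subset_roots` (`P ⊆ R`), `finrank_lieWeightSpace_le_one_of_mem_roots`
(`dim 𝔤_α ≤ 1`) and `lieWeightSpace_one_le_lieAlgebraGL_of_charZero` (`𝔤^T̂ ⊆ L(T̂)`), which give
the generation `torus_sup_rootSubgroups_eq` (Springer 8.1.1 (ii)) by
`torus_sup_rootSubgroups_eq_of_lieWeights_subset`). [cite: SpringerLAG1998, Thm. 9.6.2] -/
theorem IsSplitDual.isSplit_holds : IsSplitDual.isSplit D := by
  refine IsSplitDual.isSplit_of_finrank_le_one D
    (fun α hα => D.finrank_lieWeightSpace_le_one_of_mem_roots hα) ?_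
  intro _ hG hT
  exact torus_sup_rootSubgroups_eq_of_lieWeights_subset hG.1 hT.2.1 hT.1
    (lieWeights_subset_roots hG.2.1 hT.2.1.1 hT.1)
    (fun α hα => D.finrank_lieWeightSpace_le_one_of_mem_roots hα)
    (lieWeightSpace_one_le_lieAlgebraGL_of_charZero hG hT)

end Literature.NumberTheory.Automorphic.LGroupData.DualGroupStr
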